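import Summits.Ventures.PercRepro.MSTightProduct

/-!
# The mixed-cell lemma (TL) for tight families with a down-closed difference family

Let `F` be Marica–Schönheim-tight with `F \\ F` a down-set, supported on `u`, and let `w ⊆ u`.
Write the four cells of a member `t` with respect to `w`: `t ∩ w`, `(u \ t) ∩ (u \ w)` (the
«agreement» cells) and `t ∩ (u \ w)`, `(u \ t) ∩ w` (the «disagreement» cells). If for every
member `t` both agreement cells or both disagreement cells are differences of `F`, then `w` or its
complement `u \ w` is a member of `F` (`mem_or_sdiff_mem_of_tight_of_isDownSet`).

Proof. By `exists_downSet_upSet_of_tight_of_isDownSet` (MSTightProduct), `F = L ⊻ U` and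
`F \\ F = L ⊻ (M − U)` with `L` a down-set of subsets of `N = u \ M` and `U` an up-set within `M`.
The set `M` itself is a member (`∅ ∈ L`, `M ∈ U`), and the hypothesis at `t = M` reads: either
`M ∩ w ∈ M − U` and `N \ w ∈ L`, i.e. `u \ w = (N \ w) ∪ (M \ w) ∈ F`; or `M \ w ∈ M − U` and
`N ∩ w ∈ L`, i.e. `w = (N ∩ w) ∪ (M ∩ w) ∈ F`. No other member is needed.

This is the set-theoretic input of the regime theorem «(Θ) holds whenever some type has at most
one pair» (proofs/MINE1-singlemerge.md §17.5–17.6), here in the down-closed case — exactly the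
situation of the map world, where differences of a column are good `⊥`-sets.
-/

namespace PercRepro.MSTight

open Finset
open scoped FinsetFamily

variable {α : Type*} [DecidableEq α]

/-- Projections of a member of a product of families on disjoint supports: the `N`-part lies in
the first factor and the `M`-part in the second. -/
theorem inter_mem_of_mem_sups {S T : Finset (Finset α)} {N M : Finset α} (hNM : Disjoint N M)
    (hS : ∀ X ∈ S, X ⊆ N) (hT : ∀ Y ∈ T, Y ⊆ M) {Z : Finset α} (hZ : Z ∈ S ⊻ T) :
    Z ∩ N ∈ S ∧ Z ∩ M ∈ T := by
  obtain ⟨X, hX, Y, hY, rfl⟩ := mem_sups.1 hZ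
  rw [sup_eq_union]
  have h1 : (X ∪ Y) ∩ N = X := by
    ext s
    simp only [mem_inter, mem_union]
    constructor
    · rintro ⟨hs | hs, hsN⟩
      · exact hs
      · exact absurd hsN (Finset.disjoint_right.1 hNM (hT Y hY hs))
    · intro hs; exact ⟨Or.inl hs, hS X hX hs⟩
  have h2 : (X ∪ Y) ∩ M = Y := by
    ext s
    simp only [mem_inter, mem_union]
    constructor
    · rintro ⟨hs | hs, hsM⟩
      · exact absurd hsM (Finset.disjoint_left.1 hNM (hS X hX hs))
      · exact hs
    · intro hs; exact ⟨Or.inr hs, hT Y hY hs⟩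
  rw [h1, h2]
  exact ⟨hX, hY⟩

/-- A member of the complemented family `M − U` with `U ⊆ 2^M`: `Y ∈ complWithin M U` iff
`M \ Y ∈ U`, for `Y ⊆ M`. -/
theorem sdiff_mem_of_mem_complWithin {M : Finset α} {U : Finset (Finset α)} (hUM : ∀ Y ∈ U, Y ⊆ M)
    {Y' : Finset α} (hY' : Y' ∈ complWithin M U) : M \ Y' ∈ U := by
  obtain ⟨Y, hY, rfl⟩ := mem_complWithin.1 hY'
  rw [Finset.sdiff_sdiff_eq_self (hUM Y hY)]
  exact hY

/-- **(TL), down-closed case.** If `F` is tight with a down-closed difference family, supported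
on `u`, nonempty, and `w ⊆ u` is such that for every member `t` both agreement cells
`t ∩ w`, `(u \ t) ∩ (u \ w)` or both disagreement cells `t ∩ (u \ w)`, `(u \ t) ∩ w` are
differences of `F`, then `w ∈ F` or `u \ w ∈ F`. -/
theorem mem_or_sdiff_mem_of_tight_of_isDownSet {u w : Finset α} {F : Finset (Finset α)}
    (hF : Tight F) (hD : IsDownSet (F \\ F)) (hFu : ∀ A ∈ F, A ⊆ u) (hne : F.Nonempty)
    (hw : w ⊆ u)
    (hcond : ∀ t ∈ F, (t ∩ w ∈ F \\ F ∧ (u \ t) ∩ (u \ w) ∈ F \\ F) ∨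
      (t ∩ (u \ w) ∈ F \\ F ∧ (u \ t) ∩ w ∈ F \\ F)) :
    w ∈ F ∨ u \ w ∈ F := by
  obtain ⟨M, hMu, L, U, hL, hLN, hU, hUM, hFeq, hDeq⟩ :=
    exists_downSet_upSet_of_tight_of_isDownSet hF hD hFu
  have hNM : Disjoint (u \ M) M := Finset.sdiff_disjoint
  have hCM : ∀ Y ∈ complWithin M U, Y ⊆ M := fun Y hY => by
    obtain ⟨Y₀, _, rfl⟩ := mem_complWithin.1 hY
    exact sdiff_subset
  -- `∅ ∈ L` and `M ∈ U`
  obtain ⟨A, hA⟩ := hne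
  have hA' := hA
  rw [hFeq] at hA'
  obtain ⟨hAL, hAU⟩ := inter_mem_of_mem_sups hNM hLN hUM hA'
  have hemptyL : (∅ : Finset α) ∈ L := hL _ hAL _ (Finset.empty_subset _)
  have hMU : M ∈ U := hU _ hAU M le_rfl inter_subset_right
  -- `M` is a member
  have hMF : M ∈ F := by
    rw [hFeq]
    exact mem_sups.2 ⟨∅, hemptyL, M, hMU, by simp⟩
  -- the hypothesis at `t = M`
  rcases hcond M hMF with ⟨h1, h2⟩ | ⟨h1, h2⟩
  · -- agreement cells: `M ∩ w` and `(u \ M) ∩ (u \ w)`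
    right
    rw [hDeq] at h1 h2
    obtain ⟨_, h1M⟩ := inter_mem_of_mem_sups hNM hLN hCM h1
    obtain ⟨h2N, _⟩ := inter_mem_of_mem_sups hNM hLN hCM h2
    have hY : M \ (M ∩ w ∩ M) ∈ U := sdiff_mem_of_mem_complWithin hUM h1M
    have hX : (u \ M) ∩ (u \ w) ∩ (u \ M) ∈ L := h2N
    have e1 : (u \ M) ∩ (u \ w) ∩ (u \ M) = (u \ M) \ w := by
      ext s; simp only [mem_inter, mem_sdiff]; tauto
    have e2 : M \ (M ∩ w ∩ M) = M \ w := by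
      ext s; simp only [mem_inter, mem_sdiff]; tauto
    rw [e1] at hX
    rw [e2] at hY
    rw [hFeq]
    refine mem_sups.2 ⟨_, hX, _, hY, ?_⟩
    rw [sup_eq_union]
    ext s
    simp only [mem_union, mem_sdiff]
    constructor
    · rintro (⟨⟨hsu, _⟩, hsw⟩ | ⟨hsM, hsw⟩)
      · exact ⟨hsu, hsw⟩
      · exact ⟨hMu hsM, hsw⟩
    · rintro ⟨hsu, hsw⟩
      by_cases hsM : s ∈ M
      · exact Or.inr ⟨hsM, hsw⟩
      · exact Or.inl ⟨⟨hsu, hsM⟩, hsw⟩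
  · -- disagreement cells: `M ∩ (u \ w)` and `(u \ M) ∩ w`
    left
    rw [hDeq] at h1 h2
    obtain ⟨_, h1M⟩ := inter_mem_of_mem_sups hNM hLN hCM h1
    obtain ⟨h2N, _⟩ := inter_mem_of_mem_sups hNM hLN hCM h2
    have hY : M \ (M ∩ (u \ w) ∩ M) ∈ U := sdiff_mem_of_mem_complWithin hUM h1M
    have hX : (u \ M) ∩ w ∩ (u \ M) ∈ L := h2N
    have e1 : (u \ M) ∩ w ∩ (u \ M) = (u \ M) ∩ w := by
      ext s; simp only [mem_inter, mem_sdiff]; tauto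
    have e2 : M \ (M ∩ (u \ w) ∩ M) = M ∩ w := by
      ext s
      simp only [mem_inter, mem_sdiff]
      constructor
      · rintro ⟨hsM, h⟩
        refine ⟨hsM, ?_⟩
        by_contra hsw
        exact h ⟨⟨hsM, hMu hsM, hsw⟩, hsM⟩
      · rintro ⟨hsM, hsw⟩
        exact ⟨hsM, fun h => h.1.2.2 hsw⟩
    rw [e1] at hX
    rw [e2] at hY
    rw [hFeq]
    refine mem_sups.2 ⟨_, hX, _, hY, ?_⟩
    rw [sup_eq_union]
    ext s
    simp only [mem_union, mem_inter, mem_sdiff]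
    constructor
    · rintro (⟨_, hsw⟩ | ⟨_, hsw⟩) <;> exact hsw
    · intro hsw
      by_cases hsM : s ∈ M
      · exact Or.inr ⟨hsM, hsw⟩
      · exact Or.inl ⟨⟨hw hsw, hsM⟩, hsw⟩

end PercRepro.MSTight
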